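import Literature.AlgebraicGeometry.Motives.CartierDivisorProperIntersection
import Literature.AlgebraicGeometry.Motives.CartierDivisorIntersectionRat
import HarnessLib

/-!
# `D · [V]` is compatible with the inclusion of a closed subvariety `Y ⊇ V` (Fulton, Prop. 2.3 (c))

Fulton, *Intersection Theory* (2nd ed. 1998), Prop. 2.3 (c) (projection formula): "If `g : X' → X`
is a proper morphism, `α` a `k`-cycle on `X'`, then `g_*(g^*D · α) = D · g_*(α)`". This file proves
the case of a **closed immersion** `ι : Y ↪ X` of integral schemes locally of finite type over a
field, at the level of the CYCLES `D · α` of `Motives/CartierDivisorIntersectionCycle`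
(`CartierDivisor.primeInter`, `CartierDivisor.interCycle`; Fulton, Def. 2.3), on the components
`V ⊄ |D|` where these cycles are canonical (for `V ⊆ |D|` the tree's representatives of Fulton's
classes are chosen independently on `Y` and on `X`):

* `CartierDivisor.map_primeInter_pullbackAvoiding` — for an effective Cartier divisor `D` on `X`
  avoiding `ι(η_Y)` (so that `ι^*D = D.pullbackAvoiding ι` is an honest divisor on `Y`) and `z ∈ Y`
  with `ι z ∉ |D|`: **`ι_*((ι^*D) · [closure {z}]) = D · [closure {ι z}]`**;
* `CartierDivisor.map_interCycle_pullbackAvoiding` — **`ι_*((ι^*D) · γ) = D · ι_*γ`** for a finite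
  cycle `γ` on `Y` all of whose components lie off `|D|`.

Proof: at a point `ι w`, `z ⤳ w`, both coefficients are the order of the local equation `t` of `D`
(Fulton, Thm. 2.4, Case 1: "the coefficient of `[W]` in `D · [V]` is `ℓ_{A/p}(A/p + aA)`", the tree's
`ordAt_pullbackAvoiding_ofPoint_eq_toNat_ord_quotient` of `Motives/CartierDivisorProperIntersection`,
applied on `X` and on `Y`) in the local rings `𝒪_{X,ιw}/𝔭_{ιz}` and `𝒪_{Y,w}/𝔭_z` of the subvariety
`closure {z}` at `w`, which are isomorphic through the surjective stalk map of the closed immersion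
(`stalkQuotientEquivOfIsClosedImmersion`: the stalk maps commute with specialisation, Mathlib
`Scheme.Hom.stalkSpecializes_stalkMap`, and are local, so `𝔭_{ιz}` contracts from `𝔭_z`,
`comap_stalkMap_comap_maximalIdeal`); orders of vanishing are invariant under ring isomorphisms
(`Literature.RingTheory.OrderOfVanishing.ord_ringEquiv`). The points of the two subvarieties over
`w` have the same codimension (`coheight_ofPointPt_base_eq`, dimension formula Stacks 0A21).

Everything is proved; no named facts. Used for intersecting the push-forward `ι_*[div_Y f]` of a
rational equivalence on a subvariety of `ℙ^d` with a generic hyperplane (Fulton, Thm. 2.4 Case 1 on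
`Y`, then Prop. 2.3 (c) to return to `ℙ^d`), toward `c₁(𝒪(1)) ∩ -` on `CH_*(ℙ^d)` and the
non-torsion of the classes of linear subspaces (`Mboro2018_chowTwo_cubic`,
`Motives/LinearSubspacesGenerateChow`).

## References

* W. Fulton, *Intersection Theory*, 2nd ed., Springer 1998, Prop. 2.3 (c) (p. 34), Def. 2.3 (p. 33),
  Thm. 2.4, Case 1 of the proof (p. 36). [Fulton1998]
* The Stacks Project, Tags 01J7 (points of `Spec 𝒪_{X,x}`), 0A21 (dimension theory). [StacksProject]
-/

noncomputable section

universe u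

open CategoryTheory AlgebraicGeometry Order Topology IsLocalRing

namespace Literature.AlgebraicGeometry.Motives

open RatFn Literature.RingTheory.OrderOfVanishing

/-! ### Stalks along a closed immersion: `𝒪_{W,w}/𝔭_z ≅ 𝒪_{X,ιw}/𝔭_{ιz}` -/

section Stalks

variable {W X : Scheme.{u}} (ι : W ⟶ X)

/-- For a morphism `ι : W → X` and a specialisation `z ⤳ w` in `W`: **the prime `𝔭_{ι z} ⊂ 𝒪_{X, ι w}`
is the contraction of `𝔭_z ⊂ 𝒪_{W,w}` along the (local) stalk maps** (naturality of the stalk maps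
along specialisations, Mathlib `Scheme.Hom.stalkSpecializes_stalkMap`). [folklore] -/
theorem comap_stalkMap_comap_maximalIdeal {z w : W} (h : z ⤳ w) :
    ((maximalIdeal (W.presheaf.stalk z)).comap (W.presheaf.stalkSpecializes h).hom).comap
        (ι.stalkMap w).hom =
      (maximalIdeal (X.presheaf.stalk (ι z))).comap
        (X.presheaf.stalkSpecializes (ι.base.hom.map_specializes h)).hom := by
  rw [Ideal.comap_comap, ← CommRingCat.hom_comp, ← Scheme.Hom.stalkSpecializes_stalkMap ι z w h,
    CommRingCat.hom_comp, ← Ideal.comap_comap, maximalIdeal_comap]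

variable [IsClosedImmersion ι]

/-- **`𝒪_{X, ι w}/𝔭_{ι z} ≅ 𝒪_{W, w}/𝔭_z` for a closed immersion `ι : W ↪ X`** and `z ⤳ w` in `W`
(both are the local ring at `w` of the subvariety `closure {z}`): the stalk map `𝒪_{X,ιw} → 𝒪_{W,w}`
is surjective and pulls `𝔭_z` back to `𝔭_{ιz}`. [folklore] -/
def stalkQuotientEquivOfIsClosedImmersion {z w : W} (h : z ⤳ w) :
    (X.presheaf.stalk (ι w) ⧸ (maximalIdeal (X.presheaf.stalk (ι z))).comap
        (X.presheaf.stalkSpecializes (ι.base.hom.map_specializes h)).hom) ≃+*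
      (W.presheaf.stalk w ⧸ (maximalIdeal (W.presheaf.stalk z)).comap
        (W.presheaf.stalkSpecializes h).hom) :=
  RingEquiv.ofBijective
    (Ideal.quotientMap _ (ι.stalkMap w).hom (comap_stalkMap_comap_maximalIdeal ι h).ge)
    ⟨Ideal.quotientMap_injective' (comap_stalkMap_comap_maximalIdeal ι h).le,
      Ideal.quotientMap_surjective (ι.stalkMap_surjective w)⟩

/-- The isomorphism `𝒪_{X, ι w}/𝔭_{ι z} ≅ 𝒪_{W, w}/𝔭_z` sends `t̄` to the class of `ι^♯_w(t)`. [folklore] -/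
theorem stalkQuotientEquivOfIsClosedImmersion_mk {z w : W} (h : z ⤳ w) (t : X.presheaf.stalk (ι w)) :
    stalkQuotientEquivOfIsClosedImmersion ι h (Ideal.Quotient.mk _ t) =
      Ideal.Quotient.mk _ ((ι.stalkMap w).hom t) :=
  rfl

/-- **Orders of vanishing on `closure {z}` may be computed in `X` or in `W`**: for `t ∈ 𝒪_{X, ι w}`,
`ord_{𝒪_{X,ιw}/𝔭_{ιz}}(t̄) = ord_{𝒪_{W,w}/𝔭_z}(ι^♯_w(t))`. [folklore] -/
theorem Ring.ord_quotient_stalkMap_eq {z w : W} (h : z ⤳ w) (t : X.presheaf.stalk (ι w)) :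
    Ring.ord (W.presheaf.stalk w ⧸ (maximalIdeal (W.presheaf.stalk z)).comap
        (W.presheaf.stalkSpecializes h).hom) (Ideal.Quotient.mk _ ((ι.stalkMap w).hom t)) =
      Ring.ord (X.presheaf.stalk (ι w) ⧸ (maximalIdeal (X.presheaf.stalk (ι z))).comap
        (X.presheaf.stalkSpecializes (ι.base.hom.map_specializes h)).hom) (Ideal.Quotient.mk _ t) := by
  rw [← stalkQuotientEquivOfIsClosedImmersion_mk ι h t, ord_ringEquiv]

end Stalks

/-! ### A closed subvariety over a base is a closed immersion over the base -/

/-- The structure morphism `W.overι : W.over X.hom ⟶ X` of a closed subvariety (as a morphism over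
the base) is a closed immersion on underlying schemes (it is `W.ι`). [folklore] -/
instance ClosedSubvariety.isClosedImmersion_overι_left {S : Scheme.{u}} {X : Over S}
    (W : ClosedSubvariety X.left) : IsClosedImmersion W.overι.left :=
  inferInstanceAs (IsClosedImmersion W.ι)

/-! ### Specialisations and the subvarieties `closure {z}`, `closure {ι z}` -/

section Dimension

variable {K : Type u} [Field K] {X Y : SchemeOver K} [LocallyOfFiniteType X.hom] [LocallyOfFiniteType Y.hom]

/-- **The points of `closure {z} ⊆ Y` and of `closure {ι z} ⊆ X` over `w` resp. `ι w` have the same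
codimension** (`ι : Y ↪ X` a closed immersion of schemes locally of finite type over a field):
both closures have dimension `dim closure {z}` and both points dimension `dim closure {w}` (closed
immersions preserve dimensions of closures), and `codim = dim - dim` (Stacks 0A21). [folklore] -/
theorem coheight_ofPointPt_base_eq (ι : Y ⟶ X) [IsClosedImmersion ι.left] {z w : ↥Y.left} (hzw : z ⤳ w)
    (hι : ι.left z ⤳ ι.left w) :
    coheight (ClosedSubvariety.ofPointPt (ι.left z) hι) = coheight (ClosedSubvariety.ofPointPt z hzw) := by
  set VX := ClosedSubvariety.ofPoint X.left (ι.left z)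
  set VY := ClosedSubvariety.ofPoint Y.left z
  set vX : ↥VX.carrier := ClosedSubvariety.ofPointPt (ι.left z) hι
  set vY : ↥VY.carrier := ClosedSubvariety.ofPointPt z hzw
  -- dimension formula on `VX` and on `VY`
  have hX := Scheme.height_add_coheight_eq_height_top (VX.over X.hom).hom vX
  have hY := Scheme.height_add_coheight_eq_height_top (VY.over Y.hom).hom vY
  change height vX + coheight vX = height (⊤ : ↥VX.carrier) at hX
  change height vY + coheight vY = height (⊤ : ↥VY.carrier) at hY
  have htopX : height (⊤ : ↥VX.carrier) = height (ι.left z) := height_top_ofPoint _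
  have htopY : height (⊤ : ↥VY.carrier) = height (ι.left z) := by
    rw [height_top_ofPoint, height_base_eq_of_isClosedImmersion' ι.left z]
  have hvX : height vX = height (ι.left w) := (height_base_eq_of_isClosedImmersion' VX.ι vX).symm
  have hvY : height vY = height (ι.left w) := by
    rw [← height_base_eq_of_isClosedImmersion' VY.ι vY, ← height_base_eq_of_isClosedImmersion' ι.left]
    rfl
  rw [htopX, hvX] at hX
  rw [htopY, hvY] at hY
  exact WithTop.add_left_cancel (height_ne_top_of_locallyOfFiniteType X.hom (ι.left w)) (hX.trans hY.symm)

end Dimension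

/-! ### `D · [V]` along a closed subvariety `Y ⊇ V` -/

namespace CartierDivisor

variable {K : Type u} [Field K] {X Y : SchemeOver K} [IsIntegral X.left] [LocallyOfFiniteType X.hom]
  [IsIntegral Y.left] [LocallyOfFiniteType Y.hom]

omit [LocallyOfFiniteType X.hom] [IsIntegral Y.left] [LocallyOfFiniteType Y.hom] in
/-- The restriction `g^*D` of a divisor avoiding `g(η_Z)` avoids every `y` with `g y ∉ |D|`. [folklore] -/
theorem Avoids.pullbackAvoiding_of_base {Z : Scheme.{u}} [IsIntegral Z] {D : CartierDivisor X.left}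
    (g : Z ⟶ X.left) (hD : D.Avoids (g (genericPoint Z))) {y : Z} (hy : D.Avoids (g y)) :
    (D.pullbackAvoiding g hD).Avoids y :=
  fun i hi => (hy i.1 hi).pullbackFn

/-- **`D · [V]` may be computed inside any closed subvariety `Y ⊇ V` not contained in `|D|`, on the
components `V ⊄ |D|`** (Fulton, Prop. 2.3 (c) for the closed immersion `ι : Y ↪ X`, at the level of
cycles: `ι_*((ι^*D) · [V]) = D · ι_*[V]`). For an effective Cartier divisor `D` on `X` avoiding
`ι(η_Y)` and a point `z ∈ Y` with `ι z ∉ |D|`: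
`ι_* ((ι^*D) · [closure {z}]) = D · [closure {ι z}]` as cycles on `X`. At a point `ι w`, `z ⤳ w`,
both coefficients are the order of the local equation `t` of `D` in the one-dimensional local ring
`𝒪_{X,ιw}/𝔭_{ιz} ≅ 𝒪_{Y,w}/𝔭_z` of the subvariety at `w` (`ordAt_pullbackAvoiding_ofPoint_eq_toNat_ord_quotient`
on `X` and on `Y`, `Ring.ord_quotient_stalkMap_eq`). [cite: Fulton1998, Prop. 2.3 (c) (p. 34)] -/
theorem map_primeInter_pullbackAvoiding (ι : Y ⟶ X) [IsClosedImmersion ι.left] {D : CartierDivisor X.left}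
    (hDe : D.IsEffective) (hD : D.Avoids (ι.left (genericPoint Y.left))) {z : ↥Y.left}
    (hz : D.Avoids (ι.left z)) :
    AlgebraicCycle.map ι.left height height ((D.pullbackAvoiding ι.left hD).primeInter z) =
      D.primeInter (ι.left z) := by
  set DY := D.pullbackAvoiding ι.left hD with hDY
  ext x
  by_cases hx : x ∈ Set.range ι.left.base
  · obtain ⟨w, rfl⟩ := hx
    rw [algebraicCycleMap_apply_base_of_isClosedImmersion]
    by_cases hzw : z ⤳ w
    · have hιzw : ι.left z ⤳ ι.left w := ι.left.base.hom.map_specializes hzw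
      rw [DY.primeInter_apply_of_specializes hzw, D.primeInter_apply_of_specializes hιzw]
      -- both restrictions to the subvariety are honest pull-backs
      have hDgen : D.Avoids ((ClosedSubvariety.ofPoint X.left (ι.left z)).ι
          (genericPoint (ClosedSubvariety.ofPoint X.left (ι.left z)).carrier)) := by
        change D.Avoids (ClosedSubvariety.ofPoint X.left (ι.left z)).genericPoint
        rw [ClosedSubvariety.genericPoint_ofPoint]
        exact hz
      have hDYz : DY.Avoids z := Avoids.pullbackAvoiding_of_base ι.left hD hz
      have hDYgen : DY.Avoids ((ClosedSubvariety.ofPoint Y.left z).ι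
          (genericPoint (ClosedSubvariety.ofPoint Y.left z).carrier)) := by
        change DY.Avoids (ClosedSubvariety.ofPoint Y.left z).genericPoint
        rw [ClosedSubvariety.genericPoint_ofPoint]
        exact hDYz
      rw [pullbackRep_of_avoids _ _ hDYgen, pullbackRep_of_avoids _ _ hDgen]
      -- a chart of `D` at `ι w` and a local equation `t ∈ 𝒪_{X, ι w}`
      obtain ⟨i, hwi⟩ := D.covers (ι.left w)
      obtain ⟨t, ht⟩ := hDe i (ι.left w) hwi
      have hgi : ι.left (genericPoint Y.left) ∈ D.U i :=
        genericPoint_mem_of_mem (U := ι.left ⁻¹ᵁ D.U i) hwi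
      have hwi' : w ∈ DY.U ⟨i, hgi⟩ := hwi
      have htY : toFunctionField w ((ι.left.stalkMap w).hom t) = DY.f ⟨i, hgi⟩ := by
        change toFunctionField w ((ι.left.stalkMap w).hom t) = pullbackFn ι.left (D.f i)
        rw [← ht]
        exact (pullbackFn_toFunctionField ι.left w t).symm
      by_cases hv : coheight (ClosedSubvariety.ofPointPt (ι.left z) hιzw) = 1
      · have hv' : coheight (ClosedSubvariety.ofPointPt z hzw) = 1 := by
          rwa [coheight_ofPointPt_base_eq ι hzw hιzw] at hv
        have htz : t ∉ (maximalIdeal (X.left.presheaf.stalk (ι.left z))).comap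
            (X.left.presheaf.stalkSpecializes hιzw).hom :=
          (avoids_iff_notMem_of_eq hιzw hwi ht).1 hz
        have htYz : (ι.left.stalkMap w).hom t ∉ (maximalIdeal (Y.left.presheaf.stalk z)).comap
            (Y.left.presheaf.stalkSpecializes hzw).hom := by
          rw [← Ideal.mem_comap, comap_stalkMap_comap_maximalIdeal ι.left hzw]
          exact htz
        rw [ordAt_pullbackAvoiding_ofPoint_eq_toNat_ord_quotient hιzw hwi ht hDgen hv htz,
          ordAt_pullbackAvoiding_ofPoint_eq_toNat_ord_quotient hzw hwi' htY hDYgen hv' htYz,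
          Ring.ord_quotient_stalkMap_eq ι.left hzw t]
      · -- off codimension one both orders vanish
        have hv' : coheight (ClosedSubvariety.ofPointPt z hzw) ≠ 1 := by
          rwa [coheight_ofPointPt_base_eq ι hzw hιzw] at hv
        have h1 : (DY.pullbackAvoiding (ClosedSubvariety.ofPoint Y.left z).ι hDYgen).ordAt
            (ClosedSubvariety.ofPointPt z hzw) = 0 :=
          Classical.byContradiction fun h => hv' (coheight_eq_one_of_ordAt_ne_zero _ h)
        have h2 : (D.pullbackAvoiding (ClosedSubvariety.ofPoint X.left (ι.left z)).ι hDgen).ordAt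
            (ClosedSubvariety.ofPointPt (ι.left z) hιzw) = 0 :=
          Classical.byContradiction fun h => hv (coheight_eq_one_of_ordAt_ne_zero _ h)
        rw [h1, h2]
    · -- `¬ z ⤳ w`: both sides vanish
      rw [DY.primeInter_apply_of_not_specializes hzw, D.primeInter_apply_of_not_specializes]
      exact fun h => hzw (ι.left.isClosedEmbedding.isInducing.specializes_iff.1 h)
  · -- off `ι(Y)`: both sides vanish (`closure {ι z} ⊆ ι(Y)`)
    rw [algebraicCycleMap_apply_of_notMem_range _ _ hx, D.primeInter_apply_of_not_specializes]
    intro h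
    apply hx
    have hcl : closure {ι.left.base z} ⊆ Set.range ι.left.base :=
      ι.left.isClosedEmbedding.isClosed_range.closure_subset_iff.2
        (Set.singleton_subset_iff.2 ⟨z, rfl⟩)
    exact hcl h.mem_closure

omit [IsIntegral X.left] [LocallyOfFiniteType X.hom] [IsIntegral Y.left] [LocallyOfFiniteType Y.hom] in
/-- A cycle with finite support is the finite sum of its prime cycles with multiplicities
(Fulton §1.3; the same ten-line statement as `eq_sum_smul_primeCycle_of_support_subset` of
`Motives/LinesGenerateChowOneProofs`, not imported here). [folklore] -/
theorem eq_sum_smul_primeCycle_of_finite {Z : Scheme.{u}} (c : AlgebraicCycle Z ℤ)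
    (hfin : (Function.support c).Finite) : c = ∑ z ∈ hfin.toFinset, c z • primeCycle z := by
  classical
  ext y
  simp only [Function.locallyFinsuppWithin.coe_sum, Finset.sum_apply,
    Function.locallyFinsuppWithin.coe_zsmul, Pi.smul_apply, smul_eq_mul]
  by_cases hy : y ∈ hfin.toFinset
  · rw [Finset.sum_eq_single y, primeCycle_apply_self, mul_one]
    · intro z _ hzy
      rw [primeCycle_apply_of_ne (Ne.symm hzy), mul_zero]
    · exact fun h => (h hy).elim
  · rw [Finset.sum_eq_zero]
    · simpa using hy
    · intro z hz
      rw [primeCycle_apply_of_ne, mul_zero]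
      rintro rfl
      exact hy hz

/-- **`ι_*((ι^*D) · γ) = D · (ι_* γ)` for a finite cycle `γ` on the closed subvariety `Y` whose
components lie off `|D|`** (Fulton, Prop. 2.3 (c), `g_*(g^*D · α) = D · g_*(α)`, for the closed
immersion `ι : Y ↪ X`, at the level of cycles on the components `V ⊄ |D|`). [cite: Fulton1998, Prop. 2.3 (c) (p. 34)] -/
theorem map_interCycle_pullbackAvoiding (ι : Y ⟶ X) [IsClosedImmersion ι.left] {D : CartierDivisor X.left}
    (hDe : D.IsEffective) (hD : D.Avoids (ι.left (genericPoint Y.left)))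
    {c : AlgebraicCycle Y.left ℤ} (hc : ∀ z, c z ≠ 0 → D.Avoids (ι.left z))
    (hfin : (Function.support c).Finite) :
    AlgebraicCycle.map ι.left height height ((D.pullbackAvoiding ι.left hD).interCycle c) =
      D.interCycle (AlgebraicCycle.map ι.left height height c) := by
  classical
  let Φ : AlgebraicCycle Y.left ℤ →+ AlgebraicCycle X.left ℤ :=
    AddMonoidHom.mk' (AlgebraicCycle.map ι.left height height) (algebraicCycleMap_add ι.left _ _)
  have hΦ : ∀ a, AlgebraicCycle.map ι.left height height a = Φ a := fun a => rfl
  have h1 : AlgebraicCycle.map ι.left height height ((D.pullbackAvoiding ι.left hD).interCycle c) =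
      ∑ z ∈ hfin.toFinset, c z • D.primeInter (ι.left z) := by
    rw [interCycle_eq_sum _ hfin, hΦ, map_sum]
    refine Finset.sum_congr rfl fun z hz => ?_
    rw [map_zsmul, ← hΦ, map_primeInter_pullbackAvoiding ι hDe hD (hc z (hfin.mem_toFinset.mp hz))]
  have h2 : AlgebraicCycle.map ι.left height height c =
      ∑ z ∈ hfin.toFinset, c z • primeCycle (ι.left z) := by
    conv_lhs => rw [eq_sum_smul_primeCycle_of_finite c hfin]
    rw [hΦ, map_sum]
    refine Finset.sum_congr rfl fun z _ => ?_
    rw [map_zsmul, ← hΦ, algebraicCycleMap_primeCycle]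
  rw [h1, h2, ← interCycleHom_apply, map_sum]
  refine Finset.sum_congr rfl fun z _ => ?_
  rw [map_zsmul, interCycleHom_apply, interCycle_primeCycle]

end CartierDivisor

end Literature.AlgebraicGeometry.Motives

end
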